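import Summits.Ventures.Crystal3D.Theorems.StickyWulffConstantTextureLiminfTentBarlowFrames
import Summits.Ventures.Crystal3D.Theorems.StickyWulffConstantPolycrystalWulffBoundPolyClosure
import HarnessLib

/-!
# TB-D assembly, part 7: SLAB PIECES — layer slabs and height half-spaces as `H`-polytopes (cutting texture pieces by slabs and cut levels)
# (lane T, crux `TextureLiminfV5`, stmt-Ventures-23912; design memo TB-D-0 §8 (P0), §9)

HONEST FRAMING. Venture `Summits/Ventures/Crystal3D` (cell `crystal3d-full`), route `route-Ventures-StickyWulffConstant`, helper `--supports` the
law-v5 crux `TextureLiminfV5` (stmt-Ventures-23912).  Elementary bookkeeping (census-free, standard axioms); nothing about any cover; F-C1 not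
moved.

The texture construction (`PieceData`, TB-D-0 §9) cuts tent pieces, prisms, gap pieces and riser boxes by the LAYER SLABS of a grain's presentation
`(L, s)` and by CUT LEVELS of a wall cell's height; both must be open `H`-polytopes with unit normals for the piece ledger.  Here:
* `height_eq_inner` — `height L s y = ⟪L e₃, y⟫ − ⟪L e₃, s⟫` (`e₃ = EuclideanSpace.single 2 1`), `norm_frame_e₃`;
* `laySlab_eq_polytope` — `laySlab L s i = polytope (laySlabH L s i)` with the two unit constraints `(L e₃, (i+1)·hB + ⟪L e₃, s⟫)`,
  `(−L e₃, −(i·hB + ⟪L e₃, s⟫))`; `laySlabH_unit`;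
* `setOf_height_lt_eq_polytope` / `setOf_lt_height_eq_polytope` — the height half-spaces `{height < τ}`, `{τ < height}` as one-constraint polytopes;
* `closure_laySlab_subset` — `cl (laySlab i) ⊆ {i·hB ≤ height ≤ (i+1)·hB}`; `closure_laySlab_inter_subset_plane` — for `i ≠ j` the two
  closures meet only on a layer plane `{height = k·hB}` (so basal contacts lie on layer planes);
* `finite_slabs_meeting` — only finitely many slabs meet a bounded set;
* `polytope_inter_isBounded_left`, `emptyPieceH` / `polytope_emptyPieceH` — a bounded EMPTY piece with unit, distinct constraints (padding).
-/

noncomputable section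

namespace Summit.Ventures.Crystal3D.Cruxes.TextureLiminf.TexShadow

open Summit.Ventures.Crystal3D Summit.Ventures.Crystal3D.Theorems Set
open Summit.Ventures.Crystal3D.TentCertificate (height hB hB_pos height_move mem_laySlab_iff isOpen_laySlab)
open scoped InnerProductSpace

/-! ### Heights as inner products -/

/-- `‖L e₃‖ = 1`. -/
theorem norm_frame_e₃ (L : E3 ≃ₗᵢ[ℝ] E3) : ‖L e₃‖ = 1 := by
  rw [LinearIsometryEquiv.norm_map, e₃, PiLp.norm_single, norm_one]

/-- `height L s y = ⟪L e₃, y⟫ − ⟪L e₃, s⟫`. -/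
theorem height_eq_inner (L : E3 ≃ₗᵢ[ℝ] E3) (s y : E3) : height L s y = ⟪L e₃, y⟫_ℝ - ⟪L e₃, s⟫_ℝ := by
  have h : ⟪L e₃, y - s⟫_ℝ = (L.symm (y - s)) 2 := by
    conv_lhs => rw [← L.apply_symm_apply (y - s)]
    rw [L.inner_map_map, e₃, EuclideanSpace.inner_single_left]
    simp
  unfold height
  rw [← h, inner_sub_right]

/-! ### Layer slabs as `H`-polytopes -/

/-- the two constraints of the layer slab `i` of the presentation `(L, s)` -/
def laySlabH (L : E3 ≃ₗᵢ[ℝ] E3) (s : E3) (i : ℤ) : Finset (E3 × ℝ) :=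
  {(L e₃, ((i : ℝ) + 1) * hB + ⟪L e₃, s⟫_ℝ), (-(L e₃), -((i : ℝ) * hB + ⟪L e₃, s⟫_ℝ))}

/-- The constraints of `laySlabH` have unit normals. -/
theorem laySlabH_unit (L : E3 ≃ₗᵢ[ℝ] E3) (s : E3) (i : ℤ) : ∀ p ∈ laySlabH L s i, ‖p.1‖ = 1 := by
  intro p hp
  simp only [laySlabH, Finset.mem_insert, Finset.mem_singleton] at hp
  rcases hp with rfl | rfl
  · exact norm_frame_e₃ L
  · simp only [norm_neg]; exact norm_frame_e₃ L

/-- **The layer slab is the open `H`-polytope of its two constraints.** -/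
theorem laySlab_eq_polytope (L : E3 ≃ₗᵢ[ℝ] E3) (s : E3) (i : ℤ) : laySlab L s i = polytope (laySlabH L s i) := by
  ext y
  rw [mem_laySlab_iff, height_eq_inner]
  simp only [polytope, laySlabH, mem_iInter, mem_setOf_eq, Finset.mem_insert, Finset.mem_singleton, forall_eq_or_imp,
    forall_eq, inner_neg_left]
  constructor
  · rintro ⟨h1, h2⟩; exact ⟨by linarith, by linarith⟩
  · rintro ⟨h1, h2⟩; exact ⟨by linarith, by linarith⟩

/-- The closure of a layer slab lies in the closed slab. -/
theorem closure_laySlab_subset (L : E3 ≃ₗᵢ[ℝ] E3) (s : E3) (i : ℤ) :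
    closure (laySlab L s i) ⊆ {y : E3 | (i : ℝ) * hB ≤ height L s y ∧ height L s y ≤ ((i : ℝ) + 1) * hB} := by
  have hc : Continuous (height L s) := by
    have : height L s = fun y => ⟪L e₃, y⟫_ℝ - ⟪L e₃, s⟫_ℝ := funext (height_eq_inner L s)
    rw [this]; fun_prop
  refine closure_minimal (fun y hy => ?_) ?_
  · rw [mem_laySlab_iff] at hy; exact ⟨hy.1.le, hy.2.le⟩
  · rw [Set.setOf_and]
    exact (isClosed_le continuous_const hc).inter (isClosed_le hc continuous_const)

/-- **Basal contacts lie on layer planes**: for `i ≠ j` the closures of the slabs `i` and `j` meet only where `height = k·hB` for some integer `k`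
(namely `k = max i j` when `|i − j| = 1`; they do not meet otherwise). -/
theorem closure_laySlab_inter_subset_plane (L : E3 ≃ₗᵢ[ℝ] E3) (s : E3) {i j : ℤ} (hij : i ≠ j) :
    closure (laySlab L s i) ∩ closure (laySlab L s j) ⊆ {y : E3 | height L s y = ((max i j : ℤ) : ℝ) * hB} := by
  rintro y ⟨hi, hj⟩
  have hi' := closure_laySlab_subset L s i hi
  have hj' := closure_laySlab_subset L s j hj
  simp only [mem_setOf_eq] at hi' hj' ⊢
  have hh := hB_pos
  rcases lt_or_gt_of_ne hij with h | h
  · have hle : (i : ℝ) + 1 ≤ j := by exact_mod_cast h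
    rw [max_eq_right h.le]
    have h1 : ((i : ℝ) + 1) * hB ≤ (j : ℝ) * hB := mul_le_mul_of_nonneg_right hle hh.le
    exact le_antisymm (by linarith [hi'.2]) hj'.1
  · have hle : (j : ℝ) + 1 ≤ i := by exact_mod_cast h
    rw [max_eq_left h.le]
    have h1 : ((j : ℝ) + 1) * hB ≤ (i : ℝ) * hB := mul_le_mul_of_nonneg_right hle hh.le
    exact le_antisymm (by linarith [hj'.2]) hi'.1

/-- The layer plane `{height = c}` is the affine plane `{⟪L e₃, y⟫ = c + ⟪L e₃, s⟫}`. -/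
theorem setOf_height_eq (L : E3 ≃ₗᵢ[ℝ] E3) (s : E3) (c : ℝ) :
    {y : E3 | height L s y = c} = {y : E3 | ⟪L e₃, y⟫_ℝ = c + ⟪L e₃, s⟫_ℝ} := by
  ext y
  rw [mem_setOf_eq, mem_setOf_eq, height_eq_inner L s y]
  constructor <;> intro h <;> linarith

/-! ### Height half-spaces as one-constraint polytopes -/

/-- `{height < τ}` is the open polytope of the single constraint `(L e₃, τ + ⟪L e₃, s⟫)`. -/
theorem setOf_height_lt_eq_polytope (L : E3 ≃ₗᵢ[ℝ] E3) (s : E3) (τ : ℝ) :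
    {y : E3 | height L s y < τ} = polytope {(L e₃, τ + ⟪L e₃, s⟫_ℝ)} := by
  ext y
  simp only [polytope, mem_iInter, mem_setOf_eq, Finset.mem_singleton, forall_eq]
  rw [height_eq_inner]
  constructor <;> intro h <;> linarith

/-- `{τ < height}` is the open polytope of the single constraint `(−L e₃, −(τ + ⟪L e₃, s⟫))`. -/
theorem setOf_lt_height_eq_polytope (L : E3 ≃ₗᵢ[ℝ] E3) (s : E3) (τ : ℝ) :
    {y : E3 | τ < height L s y} = polytope {(-(L e₃), -(τ + ⟪L e₃, s⟫_ℝ))} := by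
  ext y
  simp only [polytope, mem_iInter, mem_setOf_eq, Finset.mem_singleton, forall_eq, inner_neg_left]
  rw [height_eq_inner]
  constructor <;> intro h <;> linarith

/-! ### Finiteness and padding -/

/-- **Only finitely many slabs meet a bounded set.** -/
theorem finite_slabs_meeting (L : E3 ≃ₗᵢ[ℝ] E3) (s : E3) {B : Set E3} (hB' : Bornology.IsBounded B) :
    {i : ℤ | (laySlab L s i ∩ B).Nonempty}.Finite := by
  obtain ⟨R, hR⟩ := hB'.subset_closedBall s
  have hh := hB_pos
  -- heights of points of `B` are bounded by `R`
  have hbd : ∀ y ∈ B, |height L s y| ≤ R := by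
    intro y hy
    have hy' : ‖y - s‖ ≤ R := by
      have := hR hy; rwa [Metric.mem_closedBall, dist_eq_norm] at this
    unfold height
    calc |(L.symm (y - s)) 2| ≤ ‖L.symm (y - s)‖ := by
            have h := EuclideanSpace.norm_eq (L.symm (y - s))
            rw [h, ← Real.sqrt_sq_eq_abs]
            refine Real.sqrt_le_sqrt ?_
            have hs := Finset.single_le_sum (f := fun l : Fin 3 => ‖(L.symm (y - s)) l‖ ^ 2) (fun l _ => sq_nonneg _)
              (Finset.mem_univ (2 : Fin 3))
            simpa [Real.norm_eq_abs, sq_abs] using hs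
      _ = ‖y - s‖ := LinearIsometryEquiv.norm_map _ _
      _ ≤ R := hy'
  refine (Set.finite_Icc (⌊-R / hB⌋ - 1) (⌈R / hB⌉)).subset fun i hi => ?_
  obtain ⟨y, hyS, hyB⟩ := hi
  rw [mem_laySlab_iff] at hyS
  have hy := hbd y hyB
  rw [abs_le] at hy
  constructor
  · have h1 : (i : ℝ) + 1 > -R / hB := by
      rw [gt_iff_lt, div_lt_iff₀ hh]; nlinarith [hyS.2, hy.1]
    have h2 : (⌊-R / hB⌋ : ℝ) ≤ -R / hB := Int.floor_le _
    have h3 : (⌊-R / hB⌋ : ℤ) < i + 1 := by exact_mod_cast (h2.trans_lt h1)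
    omega
  · have h1 : (i : ℝ) < R / hB := by
      rw [lt_div_iff₀ hh]; nlinarith [hyS.1, hy.2]
    have h2 : R / hB ≤ (⌈R / hB⌉ : ℝ) := Int.le_ceil _
    exact_mod_cast (h1.trans_le h2).le

/-- Adding constraints keeps a piece bounded. -/
theorem polytope_union_isBounded_left {G : Finset (E3 × ℝ)} (hG : Bornology.IsBounded (polytope G)) (H₀ : Finset (E3 × ℝ)) :
    Bornology.IsBounded (polytope (G ∪ H₀)) := by
  rw [polytope_union_eq_inter]; exact hG.subset Set.inter_subset_left

/-- a bounded EMPTY piece with unit normals and distinct planes (padding for `Fin`-indexed piece families) -/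
def emptyPieceH : Finset (E3 × ℝ) := {(e₃, 0), (-e₃, -1)}

/-- `polytope emptyPieceH = ∅`. -/
theorem polytope_emptyPieceH : polytope emptyPieceH = ∅ := by
  ext y
  simp only [polytope, emptyPieceH, mem_iInter, mem_setOf_eq, Finset.mem_insert, Finset.mem_singleton, forall_eq_or_imp,
    forall_eq, inner_neg_left, mem_empty_iff_false, iff_false, not_and, not_lt]
  intro h; linarith

/-- The padding piece has unit normals. -/
theorem emptyPieceH_unit : ∀ p ∈ emptyPieceH, ‖p.1‖ = 1 := by
  intro p hp
  simp only [emptyPieceH, Finset.mem_insert, Finset.mem_singleton] at hp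
  rcases hp with rfl | rfl
  · simp [e₃, PiLp.norm_single]
  · simp [e₃, PiLp.norm_single]

/-- The padding piece has distinct facet planes. -/
theorem emptyPieceH_planes : ∀ p ∈ emptyPieceH, ∀ p' ∈ emptyPieceH, p ≠ p' →
    {y : E3 | ⟪p.1, y⟫_ℝ = p.2} ≠ {y : E3 | ⟪p'.1, y⟫_ℝ = p'.2} := by
  have h0 : (0 : E3) ∈ {y : E3 | ⟪e₃, y⟫_ℝ = 0} := by simp
  have h0' : (0 : E3) ∉ {y : E3 | ⟪-e₃, y⟫_ℝ = -1} := by simp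
  intro p hp p' hp' hne
  simp only [emptyPieceH, Finset.mem_insert, Finset.mem_singleton] at hp hp'
  rcases hp with rfl | rfl <;> rcases hp' with rfl | rfl
  · exact absurd rfl hne
  · intro h; rw [h] at h0; exact h0' h0
  · intro h; rw [← h] at h0; exact h0' h0
  · exact absurd rfl hne

end Summit.Ventures.Crystal3D.Cruxes.TextureLiminf.TexShadow

end
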